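import Mathlib
import Summits.NavierStokesRegularity.NavierStokesRegularity.Theorems.FilamentSkeletonRssClause13ModelBandEstimate
import Summits.NavierStokesRegularity.NavierStokesRegularity.Theorems.FilamentSkeletonRssClause13LowSliceForm
import Summits.NavierStokesRegularity.NavierStokesRegularity.Theorems.FilamentSkeletonRssClause13HighSliceForm

/-!
# Clause 13-J/13-R, brick B4 (ELLIPTIC SLICES, FULL 1-D MODEL OPERATOR): the energy identity `Im⟨𝓛Y, Y⟩ = G·𝔔(Y) + Im⟨−wY′ + βY, Y⟩`
# and the low- and high-slice estimates for `𝓛Y = iG·M_qY − wY′ + β₁Y + β₂conj Y`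

Route `FilamentSkeletonRss`, ∃-side clause 13 (`Clause13RNearStraightL` stmt-NavierStokesRegularity-23612; typing-agnostic); design of record
`filament-plan/DESIGN-NOTE-28296-tenure-g22.md` §2 ("Elliptic elsewhere, with margins: low k … mid μk ∈ [1.5, C log Γ]: |σ| ≥ G·𝔖(1.5) − …") and §5
("global L² estimate first (quadratic forms: Im-part with −𝔖(μD) ≥ … on S0/S1 via Plancherel …; symbol ≥ cG on S3; transport as a global perturbation").
Companion of `…Clause13ModelBandEstimate` (p694551, the band): OUTSIDE the band the self symbol `(2/q)𝔖(z√q)` has a sign and a size, and the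
quadratic form of the full model operator sees it through its IMAGINARY part — the self term `iG·M_q` is `i`×(symmetric), transport and the local
multipliers are bounded perturbations in the pairing `⟨·, Y⟩`:

* §1 `norm_integral_mul_conj_le`, `integral_norm_mul_norm_le` — Cauchy–Schwarz for the unweighted pairing `⟨A, Y⟩ = ∫A·conj Y`;
* §2 `pairing_modelSelf_eq_selfForm` — `⟨M_qY, Y⟩ = 𝔔_ℂ(Y) := (2/q)∫conj Y·Y − ∫∫K_q(t−u)Y(u)conj Y(t)` (the model self form of B4-core, whose real part the
  slice lemmas `modelSelfForm_re_le_of_lowSlice` (p672737) / `modelSelfForm_re_ge_of_highSlice` (p673066) bound);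
* §3 `model_selfForm_bound` — **`G·|Re 𝔔_ℂ(Y)| ≤ (‖𝓛Y‖₂ + Λ‖(τ−c)Y′‖₂ + (b₁+b₂)‖Y‖₂)·‖Y‖₂`** for the full model operator, slip `w(c) = 0`, `|w′| ≤ Λ`
  (clause verbatim), bounded multipliers;
* §4 `model_highSlice_estimate` — `Ŷ = 0` on `|z|√q < b` ⟹ `G(2/q)(1 − 5e^{−b/2})‖Y‖₂² ≤ (‖𝓛Y‖₂ + Λ‖(τ−c)Y′‖₂ + (b₁+b₂)‖Y‖₂)‖Y‖₂`;
  `model_lowSlice_estimate` — `Ŷ = 0` off `a ≤ |z|√q ≤ 1/10` ⟹ `G(2/q)(a²/4)log(1/a)‖Y‖₂² ≤ (same)`.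
The transport enters only through `Λ‖(τ−c)Y′‖₂` (for a slice below wavenumber `k` this is `≲ Λ(kR + 1)‖Y‖₂` on the ball — the note's
"transport/self = 8πsRb²/(γc₁)" bookkeeping is left to the gluing step).
Lane ns-filament-19175-p1 g16; `--supports stmt-NavierStokesRegularity-23612 --as helper`.
HONEST FRAMING: inequalities about an explicit 1-D model operator attached to a HYPOTHETICAL filament skeleton on the NEGATIVE side of a MODEL route;
nothing here bears on Navier–Stokes regularity or blow-up; 23610/23612/23320 stay OPEN.
-/

noncomputable section

open MeasureTheory Real Complex Filter Set
open scoped FourierTransform ComplexConjugate Topology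
open Summit.NavierStokesRegularity.NavierStokesRegularity.Theorems.AnalyticStripLiaSymbol (liaSym)

namespace Summit.NavierStokesRegularity.NavierStokesRegularity.Theorems.MatchedKernel
set_option linter.dupNamespace false

/-! ## §1 Cauchy–Schwarz for the unweighted pairing -/

/-- `∫ ‖A‖·‖B‖ ≤ (∫‖A‖²)^{1/2}·(∫‖B‖²)^{1/2}` for `A, B ∈ L²`. [folklore] -/
theorem integral_norm_mul_norm_le {A B : ℝ → ℂ} (hA : MemLp A 2) (hB : MemLp B 2) :
    ∫ t : ℝ, ‖A t‖ * ‖B t‖ ≤ (∫ t : ℝ, ‖A t‖ ^ 2) ^ (1 / 2 : ℝ) * (∫ t : ℝ, ‖B t‖ ^ 2) ^ (1 / 2 : ℝ) := by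
  have hA' : MemLp (fun t : ℝ => ‖A t‖) (ENNReal.ofReal 2) := by
    rw [show ENNReal.ofReal (2:ℝ) = 2 by simp]; exact hA.norm
  have hB' : MemLp (fun t : ℝ => ‖B t‖) (ENNReal.ofReal 2) := by
    rw [show ENNReal.ofReal (2:ℝ) = 2 by simp]; exact hB.norm
  have h := integral_mul_le_Lp_mul_Lq_of_nonneg Real.HolderConjugate.two_two
    (Eventually.of_forall fun t => norm_nonneg (A t)) (Eventually.of_forall fun t => norm_nonneg (B t)) hA' hB'
  simp only [Real.rpow_two] at h
  exact h

/-- `A·conj Y ∈ L¹` for `A, Y ∈ L²`. [folklore] -/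
theorem integrable_mul_conj {A Y : ℝ → ℂ} (hA : MemLp A 2) (hY : MemLp Y 2) :
    Integrable (fun t : ℝ => A t * conj (Y t)) :=
  hA.integrable_mul (memLp_conj hY)

/-- `‖∫ A·conj Y‖ ≤ (∫‖A‖²)^{1/2}·(∫‖Y‖²)^{1/2}`. [folklore] -/
theorem norm_integral_mul_conj_le {A Y : ℝ → ℂ} (hA : MemLp A 2) (hY : MemLp Y 2) :
    ‖∫ t : ℝ, A t * conj (Y t)‖ ≤ (∫ t : ℝ, ‖A t‖ ^ 2) ^ (1 / 2 : ℝ) * (∫ t : ℝ, ‖Y t‖ ^ 2) ^ (1 / 2 : ℝ) := by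
  refine (norm_integral_le_integral_norm _).trans ?_
  have hpt : ∀ t : ℝ, ‖A t * conj (Y t)‖ = ‖A t‖ * ‖Y t‖ := fun t => by rw [norm_mul, Complex.norm_conj]
  simp_rw [hpt]
  exact integral_norm_mul_norm_le hA hY

/-! ## §2 The self pairing is the model self form -/

/-- **`⟨M_qY, Y⟩` is the model self form**: `∫ ((2/q)Y − K_q∗Y)·conj Y = (2/q)∫conj Y·Y − ∫∫ K_q(t−u)Y(u)conj Y(t) du dt`, for `Y ∈ L²` with
`M_qY ∈ L²`. [folklore] -/
theorem pairing_modelSelf_eq_selfForm {q : ℝ} {Y : ℝ → ℂ} (hY2 : MemLp Y 2)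
    (hM2 : MemLp (fun τ : ℝ => (2 / q : ℂ) * Y τ
      - ∫ σ : ℝ, ((((2 * q - (τ - σ) ^ 2) * (((τ - σ) ^ 2 + q) ^ (5 / 2 : ℝ))⁻¹ : ℝ)) : ℂ) * Y σ) 2) :
    ∫ t : ℝ, ((2 / q : ℂ) * Y t
        - ∫ u : ℝ, ((((2 * q - (t - u) ^ 2) * (((t - u) ^ 2 + q) ^ (5 / 2 : ℝ))⁻¹ : ℝ)) : ℂ) * Y u) * conj (Y t)
      = (2 / q : ℂ) * (∫ t : ℝ, conj (Y t) * Y t)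
        - ∫ t : ℝ, ∫ u : ℝ, ((((2 * q - (t - u) ^ 2) * (((t - u) ^ 2 + q) ^ (5 / 2 : ℝ))⁻¹ : ℝ)) : ℂ) * Y u * conj (Y t) := by
  set KY : ℝ → ℂ := fun t => ∫ u : ℝ, ((((2 * q - (t - u) ^ 2) * (((t - u) ^ 2 + q) ^ (5 / 2 : ℝ))⁻¹ : ℝ)) : ℂ) * Y u with hKY
  have hKY2 : MemLp KY 2 := by
    have h := (hY2.const_mul (2 / q : ℂ)).sub hM2
    refine MemLp.ae_eq (Eventually.of_forall fun τ => ?_) h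
    simp only [Pi.sub_apply, hKY]
    ring
  have h1 : Integrable (fun t : ℝ => (2 / q : ℂ) * Y t * conj (Y t)) := integrable_mul_conj (hY2.const_mul _) hY2
  have h2 : Integrable (fun t : ℝ => KY t * conj (Y t)) := integrable_mul_conj hKY2 hY2
  have hsplit : (fun t : ℝ => ((2 / q : ℂ) * Y t - KY t) * conj (Y t)) = fun t => (2 / q : ℂ) * Y t * conj (Y t) - KY t * conj (Y t) := by
    ext t; ring
  rw [hsplit, integral_sub h1 h2]
  congr 1
  · rw [← integral_const_mul]
    refine integral_congr_ae (Eventually.of_forall fun t => ?_)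
    simp only
    ring
  · refine integral_congr_ae (Eventually.of_forall fun t => ?_)
    simp only [hKY]
    rw [← integral_mul_const]

/-! ## §3 The full-model self-form bound -/

/-- Transport in the unweighted pairing: `‖∫ (−wY′)·conj Y‖ ≤ Λ·(∫‖(τ−c)Y′‖²)^{1/2}·(∫‖Y‖²)^{1/2}` when `w(c) = 0`, `|w′| ≤ Λ`. [folklore] -/
theorem norm_pairing0_transport_le {Y Y' : ℝ → ℂ} {c : ℝ} (hY2 : MemLp Y 2)
    (hwY'2 : MemLp (fun τ : ℝ => ((τ - c : ℝ) : ℂ) * Y' τ) 2)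
    {w : ℝ → ℝ} (hw : Differentiable ℝ w) {Λ : ℝ} (hΛ : ∀ t, |deriv w t| ≤ Λ) (hwc : w c = 0) :
    ‖∫ τ : ℝ, (-(((w τ : ℝ) : ℂ) * Y' τ)) * conj (Y τ)‖
      ≤ Λ * ((∫ τ : ℝ, ‖((τ - c : ℝ) : ℂ) * Y' τ‖ ^ 2) ^ (1 / 2 : ℝ) * (∫ τ : ℝ, ‖Y τ‖ ^ 2) ^ (1 / 2 : ℝ)) := by
  have hΛ0 : 0 ≤ Λ := (abs_nonneg _).trans (hΛ c)
  have hslip : ∀ τ, |w τ| ≤ Λ * |τ - c| := abs_slip_le hw hΛ hwc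
  have hI : Integrable (fun τ : ℝ => ‖((τ - c : ℝ) : ℂ) * Y' τ‖ * ‖Y τ‖) := hwY'2.norm.integrable_mul hY2.norm
  have hpt : ∀ τ : ℝ, ‖(-(((w τ : ℝ) : ℂ) * Y' τ)) * conj (Y τ)‖ ≤ Λ * (‖((τ - c : ℝ) : ℂ) * Y' τ‖ * ‖Y τ‖) := by
    intro τ
    simp only [norm_mul, norm_neg, Complex.norm_conj, Complex.norm_real, Real.norm_eq_abs]
    calc |w τ| * ‖Y' τ‖ * ‖Y τ‖ ≤ Λ * |τ - c| * ‖Y' τ‖ * ‖Y τ‖ := by gcongr; exact hslip τ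
      _ = Λ * (|τ - c| * ‖Y' τ‖ * ‖Y τ‖) := by ring
  refine (norm_integral_le_of_norm_le (hI.const_mul Λ) (Eventually.of_forall hpt)).trans ?_
  rw [integral_const_mul]
  exact mul_le_mul_of_nonneg_left (integral_norm_mul_norm_le hwY'2 hY2) hΛ0

/-- Local terms in the unweighted pairing: `‖∫ (β₁Y + β₂conj Y)·conj Y‖ ≤ (b₁+b₂)·∫‖Y‖²`. [folklore] -/
theorem norm_pairing0_multiplier_le {Y β₁ β₂ : ℝ → ℂ} {b₁ b₂ : ℝ} (hb₁ : ∀ τ, ‖β₁ τ‖ ≤ b₁) (hb₂ : ∀ τ, ‖β₂ τ‖ ≤ b₂)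
    (hY2 : MemLp Y 2) :
    ‖∫ τ : ℝ, (β₁ τ * Y τ + β₂ τ * conj (Y τ)) * conj (Y τ)‖ ≤ (b₁ + b₂) * ∫ τ : ℝ, ‖Y τ‖ ^ 2 := by
  have hI : Integrable (fun τ : ℝ => ‖Y τ‖ ^ 2) := (memLp_two_iff_integrable_sq_norm hY2.1).1 hY2
  have hpt : ∀ τ : ℝ, ‖(β₁ τ * Y τ + β₂ τ * conj (Y τ)) * conj (Y τ)‖ ≤ (b₁ + b₂) * ‖Y τ‖ ^ 2 := by
    intro τ
    rw [norm_mul, Complex.norm_conj]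
    have hA : ‖β₁ τ * Y τ + β₂ τ * conj (Y τ)‖ ≤ (b₁ + b₂) * ‖Y τ‖ := by
      calc ‖β₁ τ * Y τ + β₂ τ * conj (Y τ)‖ ≤ ‖β₁ τ * Y τ‖ + ‖β₂ τ * conj (Y τ)‖ := norm_add_le _ _
        _ = ‖β₁ τ‖ * ‖Y τ‖ + ‖β₂ τ‖ * ‖Y τ‖ := by rw [norm_mul, norm_mul, Complex.norm_conj]
        _ ≤ b₁ * ‖Y τ‖ + b₂ * ‖Y τ‖ := by gcongr; exacts [hb₁ τ, hb₂ τ]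
        _ = (b₁ + b₂) * ‖Y τ‖ := by ring
    calc ‖β₁ τ * Y τ + β₂ τ * conj (Y τ)‖ * ‖Y τ‖ ≤ (b₁ + b₂) * ‖Y τ‖ * ‖Y τ‖ := by gcongr
      _ = (b₁ + b₂) * ‖Y τ‖ ^ 2 := by ring
  refine (norm_integral_le_of_norm_le (hI.const_mul (b₁ + b₂)) (Eventually.of_forall hpt)).trans ?_
  rw [integral_const_mul]

/-- **THE FULL-MODEL SELF-FORM BOUND (energy identity, imaginary part).**  Let `q, G > 0`, `c : ℝ`; `Y ∈ L²` with `M_qY ∈ L²`, `Y′` a.e.-strongly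
measurable with `(τ−c)Y′ ∈ L²`; `w` a real differentiable slip with `w(c) = 0`, `|w′| ≤ Λ`; `β₁, β₂` measurable with `‖β₁‖ ≤ b₁`, `‖β₂‖ ≤ b₂`.  Then
for `𝓛Y = iG·M_qY − wY′ + β₁Y + β₂conj Y` and the model self form `𝔔_ℂ(Y) = (2/q)∫conj Y·Y − ∫∫K_q(t−u)Y(u)conj Y(t)`:
`G·|Re 𝔔_ℂ(Y)| ≤ ((∫‖𝓛Y‖²)^{1/2} + Λ(∫‖(τ−c)Y′‖²)^{1/2} + (b₁+b₂)(∫‖Y‖²)^{1/2})·(∫‖Y‖²)^{1/2}`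
(from `Im⟨𝓛Y, Y⟩ = G·Re 𝔔_ℂ(Y) + Im⟨−wY′, Y⟩ + Im⟨β₁Y + β₂conj Y, Y⟩`). [folklore; DESIGN-NOTE-28296 §5 at model level] -/
theorem model_selfForm_bound {q G : ℝ} (hG : 0 < G) {Y Y' : ℝ → ℂ} (hY2 : MemLp Y 2) (hY'm : AEStronglyMeasurable Y' volume) (c : ℝ)
    (hwY'2 : MemLp (fun τ : ℝ => ((τ - c : ℝ) : ℂ) * Y' τ) 2)
    (hM2 : MemLp (fun τ : ℝ => (2 / q : ℂ) * Y τ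
      - ∫ σ : ℝ, ((((2 * q - (τ - σ) ^ 2) * (((τ - σ) ^ 2 + q) ^ (5 / 2 : ℝ))⁻¹ : ℝ)) : ℂ) * Y σ) 2)
    {w : ℝ → ℝ} (hw : Differentiable ℝ w) {Λ : ℝ} (hΛ : ∀ t, |deriv w t| ≤ Λ) (hwc : w c = 0)
    {β₁ β₂ : ℝ → ℂ} (hβ₁m : AEStronglyMeasurable β₁ volume) (hβ₂m : AEStronglyMeasurable β₂ volume) {b₁ b₂ : ℝ}
    (hb₁ : ∀ τ, ‖β₁ τ‖ ≤ b₁) (hb₂ : ∀ τ, ‖β₂ τ‖ ≤ b₂) :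
    G * |((2 / q : ℂ) * (∫ t : ℝ, conj (Y t) * Y t)
        - ∫ t : ℝ, ∫ u : ℝ, ((((2 * q - (t - u) ^ 2) * (((t - u) ^ 2 + q) ^ (5 / 2 : ℝ))⁻¹ : ℝ)) : ℂ) * Y u * conj (Y t)).re|
      ≤ ((∫ τ : ℝ, ‖I * (G : ℂ) * ((2 / q : ℂ) * Y τ
              - ∫ σ : ℝ, ((((2 * q - (τ - σ) ^ 2) * (((τ - σ) ^ 2 + q) ^ (5 / 2 : ℝ))⁻¹ : ℝ)) : ℂ) * Y σ)
            - ((w τ : ℝ) : ℂ) * Y' τ + β₁ τ * Y τ + β₂ τ * conj (Y τ)‖ ^ 2) ^ (1 / 2 : ℝ)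
          + Λ * (∫ τ : ℝ, ‖((τ - c : ℝ) : ℂ) * Y' τ‖ ^ 2) ^ (1 / 2 : ℝ)
          + (b₁ + b₂) * (∫ τ : ℝ, ‖Y τ‖ ^ 2) ^ (1 / 2 : ℝ))
        * (∫ τ : ℝ, ‖Y τ‖ ^ 2) ^ (1 / 2 : ℝ) := by
  -- abbreviations
  set MY : ℝ → ℂ := fun τ => (2 / q : ℂ) * Y τ
      - ∫ σ : ℝ, ((((2 * q - (τ - σ) ^ 2) * (((τ - σ) ^ 2 + q) ^ (5 / 2 : ℝ))⁻¹ : ℝ)) : ℂ) * Y σ with hMYdef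
  set TY : ℝ → ℂ := fun τ => -(((w τ : ℝ) : ℂ) * Y' τ) with hTYdef
  set BY : ℝ → ℂ := fun τ => β₁ τ * Y τ + β₂ τ * conj (Y τ) with hBYdef
  set LY : ℝ → ℂ := fun τ => I * (G : ℂ) * MY τ - ((w τ : ℝ) : ℂ) * Y' τ + β₁ τ * Y τ + β₂ τ * conj (Y τ) with hLYdef
  set SF : ℂ := (2 / q : ℂ) * (∫ t : ℝ, conj (Y t) * Y t)
      - ∫ t : ℝ, ∫ u : ℝ, ((((2 * q - (t - u) ^ 2) * (((t - u) ^ 2 + q) ^ (5 / 2 : ℝ))⁻¹ : ℝ)) : ℂ) * Y u * conj (Y t) with hSFdef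
  -- `L²` membership of the pieces
  have hSY2 : MemLp (fun τ => I * (G : ℂ) * MY τ) 2 := hM2.const_mul (I * (G : ℂ))
  have hTY2 : MemLp TY 2 := (memLp_slip_mul hY'm hwY'2 hw hΛ hwc).neg
  have hBY2 : MemLp BY 2 :=
    (memLp_boundedMultiplier_mul hβ₁m hb₁ hY2).add (memLp_boundedMultiplier_mul hβ₂m hb₂ (memLp_conj hY2))
  have hLY2 : MemLp LY 2 := by
    refine ((hSY2.add hTY2).add hBY2).ae_eq (Eventually.of_forall fun τ => ?_)
    simp only [Pi.add_apply, hTYdef, hBYdef, hLYdef]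
    ring
  -- pairings
  have hPM := integrable_mul_conj hM2 hY2
  have hPT := integrable_mul_conj hTY2 hY2
  have hPB := integrable_mul_conj hBY2 hY2
  have hself : ∫ t : ℝ, MY t * conj (Y t) = SF := pairing_modelSelf_eq_selfForm hY2 hM2
  have hsplit : ∫ τ : ℝ, LY τ * conj (Y τ)
      = I * (G : ℂ) * (∫ τ : ℝ, MY τ * conj (Y τ)) + (∫ τ : ℝ, TY τ * conj (Y τ)) + ∫ τ : ℝ, BY τ * conj (Y τ) := by
    have e : (fun τ : ℝ => LY τ * conj (Y τ))
        = fun τ : ℝ => (I * (G : ℂ) * (MY τ * conj (Y τ)) + TY τ * conj (Y τ)) + BY τ * conj (Y τ) := by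
      ext τ
      simp only [hTYdef, hBYdef, hLYdef]
      ring
    have hI0 : Integrable (fun τ : ℝ => I * (G : ℂ) * (MY τ * conj (Y τ))) := hPM.const_mul _
    have hI1 : Integrable (fun τ : ℝ => I * (G : ℂ) * (MY τ * conj (Y τ)) + TY τ * conj (Y τ)) := hI0.add hPT
    rw [e, integral_add hI1 hPB, integral_add hI0 hPT, integral_const_mul]
  -- norms
  set nL : ℝ := (∫ τ : ℝ, ‖LY τ‖ ^ 2) ^ (1 / 2 : ℝ) with hnL
  set nW : ℝ := (∫ τ : ℝ, ‖((τ - c : ℝ) : ℂ) * Y' τ‖ ^ 2) ^ (1 / 2 : ℝ) with hnW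
  set nY : ℝ := (∫ τ : ℝ, ‖Y τ‖ ^ 2) ^ (1 / 2 : ℝ) with hnY
  set PL : ℂ := ∫ τ : ℝ, LY τ * conj (Y τ) with hPLdef
  set PT : ℂ := ∫ τ : ℝ, TY τ * conj (Y τ) with hPTdef
  set PB : ℂ := ∫ τ : ℝ, BY τ * conj (Y τ) with hPBdef
  have hIY : 0 ≤ ∫ τ : ℝ, ‖Y τ‖ ^ 2 := integral_nonneg fun τ => by positivity
  have hnY2 : nY * nY = ∫ τ : ℝ, ‖Y τ‖ ^ 2 := by
    rw [hnY, ← Real.rpow_add' hIY (by norm_num)]; norm_num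
  -- imaginary parts: `Im PL = G·Re SF + Im PT + Im PB`
  have himag : PL.im = G * SF.re + PT.im + PB.im := by
    rw [hsplit, hself]
    simp only [Complex.add_im]
    rw [show I * (G : ℂ) * SF = I * ((G : ℂ) * SF) by ring, Complex.I_mul_im, Complex.re_ofReal_mul]
  have h3 : |PL.im| ≤ nL * nY := (Complex.abs_im_le_norm _).trans (norm_integral_mul_conj_le hLY2 hY2)
  have h4 : |PT.im| ≤ Λ * (nW * nY) := (Complex.abs_im_le_norm _).trans (norm_pairing0_transport_le hY2 hwY'2 hw hΛ hwc)
  have h5 : |PB.im| ≤ (b₁ + b₂) * (nY * nY) := by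
    rw [hnY2]
    exact (Complex.abs_im_le_norm _).trans (norm_pairing0_multiplier_le hb₁ hb₂ hY2)
  have hkey : G * SF.re = PL.im - PT.im - PB.im := by rw [himag]; ring
  calc G * |SF.re| = |G * SF.re| := by rw [abs_mul, abs_of_pos hG]
    _ = |PL.im - PT.im - PB.im| := by rw [hkey]
    _ ≤ |PL.im| + |PT.im| + |PB.im| := by
        calc |PL.im - PT.im - PB.im| ≤ |PL.im - PT.im| + |PB.im| := abs_sub _ _
          _ ≤ |PL.im| + |PT.im| + |PB.im| := by gcongr; exact abs_sub _ _
    _ ≤ nL * nY + Λ * (nW * nY) + (b₁ + b₂) * (nY * nY) := by gcongr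
    _ = (nL + Λ * nW + (b₁ + b₂) * nY) * nY := by ring

/-! ## §4 The elliptic-slice estimates -/

/-- **HIGH-SLICE ESTIMATE for the full model operator.**  If moreover `Y ∈ L¹` and `Ŷ(z) = ∫Y e^{izx} = 0` for `|z|√q < b` (`b > 0`), then
`G·(2/q)(1 − 5e^{−b/2})·∫‖Y‖² ≤ ((∫‖𝓛Y‖²)^{1/2} + Λ(∫‖(τ−c)Y′‖²)^{1/2} + (b₁+b₂)(∫‖Y‖²)^{1/2})·(∫‖Y‖²)^{1/2}`. [folklore] -/
theorem model_highSlice_estimate {q G b : ℝ} (hq : 0 < q) (hG : 0 < G) (hb : 0 < b) {Y Y' : ℝ → ℂ} (hY1 : Integrable Y) (hY2 : MemLp Y 2)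
    (hY'm : AEStronglyMeasurable Y' volume) (c : ℝ) (hwY'2 : MemLp (fun τ : ℝ => ((τ - c : ℝ) : ℂ) * Y' τ) 2)
    (hM2 : MemLp (fun τ : ℝ => (2 / q : ℂ) * Y τ
      - ∫ σ : ℝ, ((((2 * q - (τ - σ) ^ 2) * (((τ - σ) ^ 2 + q) ^ (5 / 2 : ℝ))⁻¹ : ℝ)) : ℂ) * Y σ) 2)
    (hsupp : ∀ z : ℝ, |z| * √q < b → ∫ x : ℝ, Y x * cexp (I * z * x) = 0)
    {w : ℝ → ℝ} (hw : Differentiable ℝ w) {Λ : ℝ} (hΛ : ∀ t, |deriv w t| ≤ Λ) (hwc : w c = 0)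
    {β₁ β₂ : ℝ → ℂ} (hβ₁m : AEStronglyMeasurable β₁ volume) (hβ₂m : AEStronglyMeasurable β₂ volume) {b₁ b₂ : ℝ}
    (hb₁ : ∀ τ, ‖β₁ τ‖ ≤ b₁) (hb₂ : ∀ τ, ‖β₂ τ‖ ≤ b₂) :
    G * (2 / q * (1 - 5 * Real.exp (-(b / 2)))) * ∫ t : ℝ, ‖Y t‖ ^ 2
      ≤ ((∫ τ : ℝ, ‖I * (G : ℂ) * ((2 / q : ℂ) * Y τ
              - ∫ σ : ℝ, ((((2 * q - (τ - σ) ^ 2) * (((τ - σ) ^ 2 + q) ^ (5 / 2 : ℝ))⁻¹ : ℝ)) : ℂ) * Y σ)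
            - ((w τ : ℝ) : ℂ) * Y' τ + β₁ τ * Y τ + β₂ τ * conj (Y τ)‖ ^ 2) ^ (1 / 2 : ℝ)
          + Λ * (∫ τ : ℝ, ‖((τ - c : ℝ) : ℂ) * Y' τ‖ ^ 2) ^ (1 / 2 : ℝ)
          + (b₁ + b₂) * (∫ τ : ℝ, ‖Y τ‖ ^ 2) ^ (1 / 2 : ℝ))
        * (∫ τ : ℝ, ‖Y τ‖ ^ 2) ^ (1 / 2 : ℝ) := by
  have hlow := modelSelfForm_re_ge_of_highSlice hq hb hY1 hY2 hsupp
  have hbd := model_selfForm_bound (q := q) hG hY2 hY'm c hwY'2 hM2 hw hΛ hwc hβ₁m hβ₂m hb₁ hb₂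
  refine le_trans ?_ hbd
  rw [mul_assoc]
  exact mul_le_mul_of_nonneg_left (hlow.trans (le_abs_self _)) hG.le

/-- **LOW-SLICE ESTIMATE for the full model operator.**  If `Y ∈ L¹` and `Ŷ(z) = 0` whenever `|z|√q < a` or `|z|√q > 1/10` (`a > 0`), then
`G·(2/q)(a²/4)log(1/a)·∫‖Y‖² ≤ ((∫‖𝓛Y‖²)^{1/2} + Λ(∫‖(τ−c)Y′‖²)^{1/2} + (b₁+b₂)(∫‖Y‖²)^{1/2})·(∫‖Y‖²)^{1/2}` — the LIA-log gain of the
ball-scale slice against transport and strain. [folklore] -/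
theorem model_lowSlice_estimate {q G a : ℝ} (hq : 0 < q) (hG : 0 < G) (ha : 0 < a) {Y Y' : ℝ → ℂ} (hY1 : Integrable Y) (hY2 : MemLp Y 2)
    (hY'm : AEStronglyMeasurable Y' volume) (c : ℝ) (hwY'2 : MemLp (fun τ : ℝ => ((τ - c : ℝ) : ℂ) * Y' τ) 2)
    (hM2 : MemLp (fun τ : ℝ => (2 / q : ℂ) * Y τ
      - ∫ σ : ℝ, ((((2 * q - (τ - σ) ^ 2) * (((τ - σ) ^ 2 + q) ^ (5 / 2 : ℝ))⁻¹ : ℝ)) : ℂ) * Y σ) 2)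
    (hsupp : ∀ z : ℝ, (|z| * √q < a ∨ 1 / 10 < |z| * √q) → ∫ x : ℝ, Y x * cexp (I * z * x) = 0)
    {w : ℝ → ℝ} (hw : Differentiable ℝ w) {Λ : ℝ} (hΛ : ∀ t, |deriv w t| ≤ Λ) (hwc : w c = 0)
    {β₁ β₂ : ℝ → ℂ} (hβ₁m : AEStronglyMeasurable β₁ volume) (hβ₂m : AEStronglyMeasurable β₂ volume) {b₁ b₂ : ℝ}
    (hb₁ : ∀ τ, ‖β₁ τ‖ ≤ b₁) (hb₂ : ∀ τ, ‖β₂ τ‖ ≤ b₂) :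
    G * (2 / q * (a ^ 2 / 4) * Real.log (1 / a)) * ∫ t : ℝ, ‖Y t‖ ^ 2
      ≤ ((∫ τ : ℝ, ‖I * (G : ℂ) * ((2 / q : ℂ) * Y τ
              - ∫ σ : ℝ, ((((2 * q - (τ - σ) ^ 2) * (((τ - σ) ^ 2 + q) ^ (5 / 2 : ℝ))⁻¹ : ℝ)) : ℂ) * Y σ)
            - ((w τ : ℝ) : ℂ) * Y' τ + β₁ τ * Y τ + β₂ τ * conj (Y τ)‖ ^ 2) ^ (1 / 2 : ℝ)
          + Λ * (∫ τ : ℝ, ‖((τ - c : ℝ) : ℂ) * Y' τ‖ ^ 2) ^ (1 / 2 : ℝ)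
          + (b₁ + b₂) * (∫ τ : ℝ, ‖Y τ‖ ^ 2) ^ (1 / 2 : ℝ))
        * (∫ τ : ℝ, ‖Y τ‖ ^ 2) ^ (1 / 2 : ℝ) := by
  have hup := modelSelfForm_re_le_of_lowSlice hq ha hY1 hY2 hsupp
  have hbd := model_selfForm_bound (q := q) hG hY2 hY'm c hwY'2 hM2 hw hΛ hwc hβ₁m hβ₂m hb₁ hb₂
  refine le_trans ?_ hbd
  have hneg : G * (2 / q * (a ^ 2 / 4) * Real.log (1 / a)) * ∫ t : ℝ, ‖Y t‖ ^ 2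
      = G * (-( -(2 / q * (a ^ 2 / 4) * Real.log (1 / a)) * ∫ t : ℝ, ‖Y t‖ ^ 2)) := by ring
  rw [hneg]
  exact mul_le_mul_of_nonneg_left ((neg_le_neg hup).trans (neg_le_abs _)) hG.le

end Summit.NavierStokesRegularity.NavierStokesRegularity.Theorems.MatchedKernel

end
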